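import Literature.Geometry.DiscreteGeometry.KissingSearchNode
import HarnessLib

/-!
# Counting sides and contacts; the growth step of the kissing search keeps states realized

Topic `Literature/Geometry/DiscreteGeometry`; provefact brick for `Hales2012_contactGraphTame` /
`Hales2012_contactGraphFccOrHcp`, part 6.  Everything here is PROVED; nothing is named.

(The relabelling `KConf.relabel σ` itself, `KConf.sides / longSides / ty / RootInv` and
`trueCode` are defined in `KissingSearchDefs.lean`.)

* Part B — counting in `M`: the sides of the twenty triangles number `30`
  (`card_sides`), at most `7` of them are long (`card_longSides_le`); in a realized state
  `cdeg ≤ 4`, `nlong ≤ 7`; the root normalisation `RootInv` (four contacts and at most one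
  long side at `0`, the reflection tie-break) makes `countKill`, `rootKill` never fire;
  `hdeg2 v = 0 ↔ v` unused;
* Part C — **`realizes_grow`**: adding the missing triangle on an open side with truthful labels
  of its two new sides keeps the state realized; the truthful labels are among `labelOpts`.

## References
* T. C. Hales, arXiv:1209.6043 (2012), Lemma 7 and proof of Theorem 3 (`#E₂ ≥ 23`,
  `≤ 4` contacts per node). [`Hales2012`]
-/

namespace Literature.Geometry.DiscreteGeometry

namespace KissingSearch

open Real Literature.Analysis.ValidatedNumerics KissingLP NonemptyInterval Finset

/-! ### Part B. Counting sides -/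

section Sides

variable (M : KConf)


/-- Membership in `sides`. [folklore] -/
theorem KConf.mem_sides {e : Finset ℕ} : e ∈ M.sides ↔ e.card = 2 ∧ ∃ t ∈ M.T, e ⊆ t := by
  unfold KConf.sides
  rw [Finset.mem_biUnion]
  constructor
  · rintro ⟨t, ht, he⟩
    rw [Finset.mem_powersetCard] at he
    exact ⟨he.2, t, ht, he.1⟩
  · rintro ⟨hc, t, ht, he⟩
    exact ⟨t, ht, Finset.mem_powersetCard.2 ⟨he, hc⟩⟩

/-- **The triangles have thirty sides** (`3 · 20 = 2 · 30`). [cite: Hales2012, proof of Theorem 3] -/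
theorem KConf.card_sides : M.sides.card = 30 := by
  classical
  -- double counting of incidences
  have hinc : ∑ e ∈ M.sides, (M.T.filter fun t => e ⊆ t).card = ∑ t ∈ M.T, (M.sides.filter fun e => e ⊆ t).card := by
    simp only [Finset.card_eq_sum_ones, Finset.sum_filter]
    exact Finset.sum_comm
  have hleft : ∀ e ∈ M.sides, (M.T.filter fun t => e ⊆ t).card = 2 := by
    intro e he
    obtain ⟨hc, t, ht, het⟩ := (M.mem_sides).1 he
    obtain ⟨p, q, hpq, rfl⟩ := Finset.card_eq_two.1 hc
    have hp : p ∈ t := het (by simp)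
    have hq : q ∈ t := het (by simp)
    rw [← M.two t ht p hp q hq hpq]
    congr 1
    ext t'
    simp only [Finset.mem_filter, Finset.insert_subset_iff, Finset.singleton_subset_iff]
  have hright : ∀ t ∈ M.T, (M.sides.filter fun e => e ⊆ t).card = 3 := by
    intro t ht
    have : M.sides.filter (fun e => e ⊆ t) = t.powersetCard 2 := by
      ext e
      rw [Finset.mem_filter, M.mem_sides, Finset.mem_powersetCard]
      constructor
      · rintro ⟨⟨hc, -⟩, he⟩; exact ⟨he, hc⟩
      · rintro ⟨he, hc⟩; exact ⟨⟨hc, t, ht, he⟩, he⟩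
    rw [this, Finset.card_powersetCard, (M.mem_T t ht).1]
    rfl
  rw [Finset.sum_congr rfl hleft, Finset.sum_congr rfl hright, Finset.sum_const, Finset.sum_const, M.card_T] at hinc
  simp only [smul_eq_mul] at hinc
  omega


/-- **At most seven long sides** (at least `23` of the `30` sides are contacts).
[cite: Hales2012, Lemma 7 and proof of Theorem 3] -/
theorem KConf.card_longSides_le : M.longSides.card ≤ 7 := by
  classical
  -- the contact pairs inject into the non-long sides
  set C := ((Finset.range 12) ×ˢ (Finset.range 12)).filter fun p => p.1 < p.2 ∧ M.g p.1 p.2 = 1 / 2 with hC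
  have hCcard := M.contacts_ge
  have himg : (C.image fun p => ({p.1, p.2} : Finset ℕ)) ⊆ M.sides.filter fun e => ¬ ∃ p ∈ e, ∃ q ∈ e, p ≠ q ∧ M.g p q ≠ 1 / 2 := by
    intro e he
    rw [Finset.mem_image] at he
    obtain ⟨p, hp, rfl⟩ := he
    rw [hC, Finset.mem_filter, Finset.mem_product, Finset.mem_range, Finset.mem_range] at hp
    obtain ⟨⟨h1, h2⟩, hlt, hg⟩ := hp
    obtain ⟨t, ht, hpt, hqt⟩ := M.contact_side _ _ h1 h2 (ne_of_lt hlt) hg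
    rw [Finset.mem_filter, M.mem_sides]
    refine ⟨⟨by rw [Finset.card_pair (ne_of_lt hlt)], t, ht, ?_⟩, ?_⟩
    · intro x hx; simp only [Finset.mem_insert, Finset.mem_singleton] at hx
      rcases hx with rfl | rfl
      · exact hpt
      · exact hqt
    · rintro ⟨x, hx, y, hy, hxy, hgxy⟩
      simp only [Finset.mem_insert, Finset.mem_singleton] at hx hy
      rcases hx with rfl | rfl <;> rcases hy with rfl | rfl
      · exact hxy rfl
      · exact hgxy hg
      · rw [M.g_symm] at hgxy; exact hgxy hg
      · exact hxy rfl
  have hinj : Set.InjOn (fun p : ℕ × ℕ => ({p.1, p.2} : Finset ℕ)) C := by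
    intro p hp p' hp' e
    rw [hC, Finset.mem_coe, Finset.mem_filter] at hp hp'
    simp only at e
    have h1 : p.1 ∈ ({p'.1, p'.2} : Finset ℕ) := by rw [← e]; simp
    have h2 : p.2 ∈ ({p'.1, p'.2} : Finset ℕ) := by rw [← e]; simp
    simp only [Finset.mem_insert, Finset.mem_singleton] at h1 h2
    have := hp.2.1; have := hp'.2.1
    exact Prod.ext (by omega) (by omega)
  have hcardimg : (C.image fun p => ({p.1, p.2} : Finset ℕ)).card = C.card := Finset.card_image_of_injOn hinj
  have hsplit := Finset.card_filter_add_card_filter_not (s := M.sides)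
    (p := fun e => ∃ p ∈ e, ∃ q ∈ e, p ≠ q ∧ M.g p q ≠ 1 / 2)
  rw [M.card_sides] at hsplit
  have h23 : 23 ≤ (M.sides.filter fun e => ¬ ∃ p ∈ e, ∃ q ∈ e, p ≠ q ∧ M.g p q ≠ 1 / 2).card :=
    le_trans hCcard (by rw [← hcardimg]; exact Finset.card_le_card himg)
  unfold KConf.longSides
  omega

end Sides

/-! ### Part C. Counting in a realized state; the growth step -/

section Grow

variable {M : KConf} {s : St}

/-- **Meaning of `cdeg`**: the number of labels `u ≠ v`, `u < 12` with contact code on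
`{u, v}`. [folklore] -/
theorem cdeg_eq (s : St) (v : ℕ) :
    s.cdeg v = ((List.range' 0 12).filter fun u => u ≠ v ∧ s.gdom u v = 0).length := by
  unfold St.cdeg
  rw [foldRange_eq_foldl]
  suffices h : ∀ (L : List ℕ) (n : ℕ),
      L.foldl (fun n u => if u ≠ v ∧ s.gdom u v = 0 then n + 1 else n) n =
        n + (L.filter fun u => u ≠ v ∧ s.gdom u v = 0).length by
    simpa using h (List.range' 0 12) 0
  intro L
  induction L with
  | nil => intro n; simp
  | cons u L ih =>
    intro n
    rw [List.foldl_cons, ih, List.filter_cons]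
    by_cases h : u ≠ v ∧ s.gdom u v = 0
    · rw [if_pos h]; simp [h]; omega
    · rw [if_neg h]; simp [h]

/-- In a realized state `cdeg v ≤ 4`. [cite: Hales2012, Lemma 7] -/
theorem cdeg_le_four (hR : Realizes M s) {v : ℕ} (hv : v < 12) : s.cdeg v ≤ 4 := by
  classical
  rw [cdeg_eq]
  refine le_trans ?_ (M.cdeg_le v hv)
  rw [← List.toFinset_card_of_nodup (List.Nodup.filter _ List.nodup_range')]
  apply Finset.card_le_card
  intro u hu
  rw [List.mem_toFinset, List.mem_filter, List.mem_range'_1] at hu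
  simp only [decide_eq_true_eq] at hu
  obtain ⟨hu12, huv, h0⟩ := hu
  rw [Finset.mem_filter, Finset.mem_range]
  refine ⟨by omega, huv, ?_⟩
  rcases hR.dom u v (by omega) hv huv with h | ⟨-, h⟩ | ⟨-, h, -⟩
  · rw [h0] at h; exact absurd h (by unfold UNL; norm_num)
  · rw [M.g_symm]; exact h
  · exact absurd h0 h

/-- **Meaning of `nlong`**: the number of side indices `i < 144` with `i / 12 < i % 12` carrying
a long code. [folklore] -/
theorem nlong_eq (s : St) :
    s.nlong = ((List.range' 0 144).filter fun i => i / 12 < i % 12 ∧ s.dom.getD i UNL ≠ 0 ∧ s.dom.getD i UNL ≠ UNL).length := by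
  unfold St.nlong
  rw [foldRange_eq_foldl]
  suffices h : ∀ (L : List ℕ) (n : ℕ),
      L.foldl (fun n i => if i / 12 < i % 12 then
        (let r := s.dom.getD i UNL; if r ≠ 0 ∧ r ≠ UNL then n + 1 else n) else n) n =
        n + (L.filter fun i => i / 12 < i % 12 ∧ s.dom.getD i UNL ≠ 0 ∧ s.dom.getD i UNL ≠ UNL).length by
    simpa using h (List.range' 0 144) 0
  intro L
  induction L with
  | nil => intro n; simp
  | cons i L ih =>
    intro n
    rw [List.foldl_cons, ih, List.filter_cons]
    by_cases hP : i / 12 < i % 12 ∧ s.dom.getD i UNL ≠ 0 ∧ s.dom.getD i UNL ≠ UNL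
    · rw [if_pos (decide_eq_true hP)]
      have e : (if i / 12 < i % 12 then (let r := s.dom.getD i UNL; if r ≠ 0 ∧ r ≠ UNL then n + 1 else n) else n) = n + 1 := by
        rw [if_pos hP.1]; exact if_pos hP.2
      rw [e, List.length_cons]; omega
    · rw [if_neg (fun h => hP (of_decide_eq_true h))]
      have e : (if i / 12 < i % 12 then (let r := s.dom.getD i UNL; if r ≠ 0 ∧ r ≠ UNL then n + 1 else n) else n) = n := by
        by_cases h1 : i / 12 < i % 12
        · rw [if_pos h1]; exact if_neg (fun h2 => hP ⟨h1, h2⟩)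
        · rw [if_neg h1]
      rw [e]

/-- In a realized state `nlong ≤ 7`. [cite: Hales2012, Lemma 7 and proof of Theorem 3] -/
theorem nlong_le_seven (hR : Realizes M s) : s.nlong ≤ 7 := by
  classical
  rw [nlong_eq]
  refine le_trans ?_ M.card_longSides_le
  rw [← List.toFinset_card_of_nodup (List.Nodup.filter _ List.nodup_range')]
  -- injection `i ↦ {i / 12, i % 12}`
  refine Finset.card_le_card_of_injOn (fun i => ({i / 12, i % 12} : Finset ℕ)) ?_ ?_
  · intro i hi
    rw [Finset.mem_coe, List.mem_toFinset, List.mem_filter, List.mem_range'_1] at hi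
    simp only [decide_eq_true_eq] at hi
    obtain ⟨hi144, hlt, h0, hU⟩ := hi
    set a := i / 12 with ha
    set b := i % 12 with hb
    have ha12 : a < 12 := by omega
    have hb12 : b < 12 := by omega
    have hab : a ≠ b := by omega
    have hidx : sIdx a b = i := by unfold sIdx; rw [if_pos hlt]; omega
    have hg : s.gdom a b = s.dom.getD i UNL := by unfold St.gdom; rw [hidx]
    obtain ⟨t, ht, hat, hbt⟩ := hR.lab_side a b ha12 hb12 hab (by rw [hg]; exact hU)
    unfold KConf.longSides
    rw [Finset.mem_coe, Finset.mem_filter, M.mem_sides]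
    refine ⟨⟨by rw [Finset.card_pair hab], tset t, hR.mem t ht, ?_⟩, a, Finset.mem_insert.2 (Or.inl ha), b,
      Finset.mem_insert_of_mem (Finset.mem_singleton.2 hb), hab, ?_⟩
    · intro x hx; simp only [Finset.mem_insert, Finset.mem_singleton] at hx
      rcases hx with rfl | rfl
      · exact hat
      · exact hbt
    · rcases hR.dom a b ha12 hb12 hab with h | ⟨h, -⟩ | ⟨-, -, h, -⟩
      · rw [hg] at h; exact absurd h hU
      · rw [hg] at h; exact absurd h h0
      · exact h
  · intro i hi j hj e
    rw [Finset.mem_coe, List.mem_toFinset, List.mem_filter, List.mem_range'_1] at hi hj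
    simp only [decide_eq_true_eq] at hi hj
    simp only at e
    have h1 : i / 12 ∈ ({j / 12, j % 12} : Finset ℕ) := by rw [← e]; simp
    have h2 : i % 12 ∈ ({j / 12, j % 12} : Finset ℕ) := by rw [← e]; simp
    simp only [Finset.mem_insert, Finset.mem_singleton] at h1 h2
    omega



/-- **Meaning of `nlongAt`.** [folklore] -/
theorem nlongAt_eq (s : St) (v : ℕ) :
    s.nlongAt v = ((List.range' 0 12).filter fun u => u ≠ v ∧ s.gdom v u ≠ 0 ∧ s.gdom v u ≠ UNL).length := by
  unfold St.nlongAt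
  rw [foldRange_eq_foldl]
  suffices h : ∀ (L : List ℕ) (n : ℕ),
      L.foldl (fun n u => if u ≠ v ∧ s.gdom v u ≠ 0 ∧ s.gdom v u ≠ UNL then n + 1 else n) n =
        n + (L.filter fun u => u ≠ v ∧ s.gdom v u ≠ 0 ∧ s.gdom v u ≠ UNL).length by
    simpa using h (List.range' 0 12) 0
  intro L
  induction L with
  | nil => intro n; simp
  | cons u L ih =>
    intro n
    rw [List.foldl_cons, ih, List.filter_cons]
    by_cases h : u ≠ v ∧ s.gdom v u ≠ 0 ∧ s.gdom v u ≠ UNL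
    · rw [if_pos h, if_pos (decide_eq_true h), List.length_cons]; omega
    · rw [if_neg h, if_neg (fun h' => h (of_decide_eq_true h'))]

/-- A labelled long side at `0` is a long side of `M` through `0`. [folklore] -/
theorem longSide_of_label {M : KConf} {s : St} (hR : Realizes M s) {u : ℕ} (hu : u < 12) (hu0 : u ≠ 0)
    (h0 : s.gdom 0 u ≠ 0) (hU : s.gdom 0 u ≠ UNL) : ({0, u} : Finset ℕ) ∈ M.longSides := by
  obtain ⟨t, ht, h0t, hut⟩ := hR.lab_side 0 u (by norm_num) hu (Ne.symm hu0) hU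
  unfold KConf.longSides
  rw [Finset.mem_filter, M.mem_sides]
  refine ⟨⟨by rw [Finset.card_pair (Ne.symm hu0)], tset t, hR.mem t ht, ?_⟩, 0, by simp, u, by simp, Ne.symm hu0, ?_⟩
  · intro x hx; simp only [Finset.mem_insert, Finset.mem_singleton] at hx
    rcases hx with rfl | rfl
    · exact h0t
    · exact hut
  · rcases hR.dom 0 u (by norm_num) hu (Ne.symm hu0) with h | ⟨h, -⟩ | ⟨-, -, h, -⟩
    · exact absurd h hU
    · exact absurd h h0
    · exact h

/-- Under the root normalisation, at most one labelled long side at `0`. [folklore] -/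
theorem nlongAt_zero_le_one {M : KConf} {s : St} (hR : Realizes M s) (hI : M.RootInv) : s.nlongAt 0 ≤ 1 := by
  rw [nlongAt_eq]
  by_contra h
  push Not at h
  set L := (List.range' 0 12).filter fun u => u ≠ 0 ∧ s.gdom 0 u ≠ 0 ∧ s.gdom 0 u ≠ UNL with hL
  have hnd : L.Nodup := List.Nodup.filter _ List.nodup_range'
  obtain ⟨u, w, huw, hu, hw⟩ : ∃ u w, u ≠ w ∧ u ∈ L ∧ w ∈ L := by
    match L, h, hnd with
    | u :: w :: _, _, hnd =>
      refine ⟨u, w, ?_, by simp, by simp⟩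
      rw [List.nodup_cons] at hnd
      exact fun e => hnd.1 (by rw [e]; simp)
  rw [hL] at hu hw
  simp only [List.mem_filter, List.mem_range'_1, decide_eq_true_eq] at hu hw
  have lu := longSide_of_label hR (by omega) hu.2.1 hu.2.2.1 hu.2.2.2
  have lw := longSide_of_label hR (by omega) hw.2.1 hw.2.2.1 hw.2.2.2
  exact huw (hI.2.1 u w lu lw)

/-- The type read from a label agrees with the type in `M`. [folklore] -/
theorem ty_eq_of_label {M : KConf} {s : St} (hR : Realizes M s) {p q : ℕ} (hp : p < 12) (hq : q < 12) (hpq : p ≠ q)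
    (hU : s.gdom p q ≠ UNL) : M.ty p q = if s.gdom p q = 0 then 0 else 1 := by
  unfold KConf.ty
  rcases hR.dom p q hp hq hpq with h | ⟨h, hg⟩ | ⟨-, h, hg, -⟩
  · exact absurd h hU
  · rw [if_pos hg, if_pos h]
  · rw [if_neg hg, if_neg h]

/-- Under the root normalisation, the tie-break never kills. [folklore] -/
theorem tbKill_false {M : KConf} {s : St} (hR : Realizes M s) (hI : M.RootInv) : s.tbKill = false := by
  unfold St.tbKill
  simp only
  by_contra h
  rw [Bool.not_eq_false] at h
  simp only [Bool.and_eq_true, bne_iff_ne, ne_eq, Bool.or_eq_true, decide_eq_true_eq, beq_iff_eq] at h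
  obtain ⟨⟨⟨⟨h03, h13⟩, h04⟩, h24⟩, hlex⟩ := h
  have e03 := ty_eq_of_label hR (by norm_num) (by norm_num) (by norm_num) h03
  have e13 := ty_eq_of_label hR (by norm_num) (by norm_num) (by norm_num) h13
  have e04 := ty_eq_of_label hR (by norm_num) (by norm_num) (by norm_num) h04
  have e24 := ty_eq_of_label hR (by norm_num) (by norm_num) (by norm_num) h24
  apply hI.2.2
  rw [e03, e13, e04, e24]
  exact hlex

/-- **`countKill` is `false` on a realized state** under the root normalisation (labels `< 12`).
[folklore] -/
theorem countKill_false (hR : Realizes M s) (hI : M.RootInv) {v a c : ℕ} (hv : v < 12) (ha : a < 12) (hc : c < 12) :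
    s.countKill v a c = false := by
  unfold St.countKill
  have h1 := cdeg_le_four hR hv
  have h2 := cdeg_le_four hR ha
  have h3 := cdeg_le_four hR hc
  have h4 := nlong_le_seven hR
  have h5 := nlongAt_zero_le_one hR hI
  have h6 := tbKill_false hR hI
  simp only [Bool.or_eq_false_iff, decide_eq_false_iff_not, not_lt, h6]
  exact ⟨⟨⟨⟨⟨h1, h2⟩, h3⟩, h4⟩, h5⟩, trivial⟩

/-- Under the root normalisation, the closed-root kill never fires: when every side at `0` lies in
`0` or `2` placed triangles, all triangles of `M` at `0` are placed, so the four contacts of `0`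
are labelled and counted. [folklore] -/
theorem rootKill_false (hR : Realizes M s) (hI : M.RootInv) : s.rootKill = false := by
  classical
  unfold St.rootKill
  rw [show s.linkSummary 0 = ((s.linkSummary 0).1, (s.linkSummary 0).2.1, (s.linkSummary 0).2.2.1, (s.linkSummary 0).2.2.2)
    from rfl]
  simp only
  rw [linkSummary_eq]
  simp only
  by_contra h
  rw [Bool.not_eq_false] at h
  simp only [Bool.and_eq_true, bne_iff_ne, ne_eq, beq_iff_eq] at h
  obtain ⟨⟨hnv, hne⟩, hc⟩ := h
  apply hc
  -- all triangles at `0` are placed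
  have hne' : ∀ u, u < 12 → u ≠ 0 → s.gsc 0 u ≠ 1 := by
    intro u hu hu0 h1
    have : u ∈ (List.range' 0 12).filter (fun u => u ≠ 0 ∧ s.gsc 0 u = 1) := by
      simp only [List.mem_filter, List.mem_range'_1, decide_eq_true_eq]; exact ⟨by omega, hu0, h1⟩
    rw [List.length_eq_zero_iff.1 hne] at this; simp at this
  obtain ⟨u₀, hu₀⟩ := List.exists_mem_of_ne_nil ((List.range' 0 12).filter fun u => u ≠ 0 ∧ s.gsc 0 u ≠ 0)
    (fun e => hnv (by rw [e]; rfl))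
  simp only [List.mem_filter, List.mem_range'_1, decide_eq_true_eq] at hu₀
  obtain ⟨hu₀12, hu₀0, hg₀⟩ := hu₀
  rw [gsc_eq_length hR (by norm_num) (by omega) (Ne.symm hu₀0)] at hg₀
  obtain ⟨t₀, ht₀⟩ := List.exists_mem_of_ne_nil (s.onSideL 0 u₀) (fun e => hg₀ (by rw [e]; rfl))
  unfold St.onSideL at ht₀; rw [List.mem_filter] at ht₀; simp only [Bool.and_eq_true] at ht₀
  have placed : ∀ t'' ∈ M.T, 0 ∈ t'' → ∃ t ∈ s.tris.toList, tset t = t'' :=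
    fun t'' hT h0 => all_placed_of_closed hR (by norm_num) hne' ht₀.1 (tmem_iff.1 ht₀.2.1) hT h0
  -- the contacts of `0` are exactly the labels with contact code
  rw [cdeg_eq, ← hI.1, ← List.toFinset_card_of_nodup (List.Nodup.filter _ List.nodup_range')]
  congr 1
  ext u
  rw [List.mem_toFinset, List.mem_filter, List.mem_range'_1, Finset.mem_filter, Finset.mem_range]
  simp only [decide_eq_true_eq]
  constructor
  · rintro ⟨hu, hu0, h0⟩
    refine ⟨by omega, hu0, ?_⟩
    rcases hR.dom u 0 (by omega) (by norm_num) hu0 with h | ⟨-, h⟩ | ⟨-, h, -⟩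
    · rw [h0] at h; exact absurd h (by unfold UNL; norm_num)
    · rw [M.g_symm]; exact h
    · exact absurd h0 h
  · rintro ⟨hu, hu0, hg⟩
    refine ⟨by omega, hu0, ?_⟩
    obtain ⟨t'', hT, h0t, hut⟩ := M.contact_side 0 u (by norm_num) hu (Ne.symm hu0) hg
    obtain ⟨t, ht, e⟩ := placed t'' hT h0t
    have hl := hR.side_lab t ht 0 (by rw [e]; exact h0t) u (by rw [e]; exact hut) (Ne.symm hu0)
    rw [gdom_comm] at hl
    rcases hR.dom u 0 (by omega) (by norm_num) hu0 with h | ⟨h, -⟩ | ⟨-, -, h, -⟩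
    · exact absurd h hl
    · exact h
    · rw [M.g_symm] at hg; exact absurd hg h

/-- **Meaning of `hdeg2`**: the sum of the side counts at `v`. [folklore] -/
theorem hdeg2_eq (s : St) (v : ℕ) :
    s.hdeg2 v = (((List.range' 0 12).filter fun u => u ≠ v).map fun u => s.gsc v u).sum := by
  unfold St.hdeg2
  rw [foldRange_eq_foldl]
  suffices h : ∀ (L : List ℕ) (n : ℕ),
      L.foldl (fun n u => if u = v then n else n + s.gsc v u) n = n + ((L.filter fun u => u ≠ v).map fun u => s.gsc v u).sum by
    simpa using h (List.range' 0 12) 0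
  intro L
  induction L with
  | nil => intro n; simp
  | cons u L ih =>
    intro n
    rw [List.foldl_cons, ih, List.filter_cons]
    by_cases h : u = v
    · simp [h]
    · simp [h]; omega

/-- **A label is used iff `hdeg2 ≠ 0`.** [folklore] -/
theorem used_iff_hdeg2 (hR : Realizes M s) {v : ℕ} (hv : v < 12) :
    (∃ t ∈ s.tris.toList, v ∈ tset t) ↔ s.hdeg2 v ≠ 0 := by
  rw [hdeg2_eq]
  constructor
  · rintro ⟨t, ht, hvt⟩
    obtain ⟨n1, -, -, hset⟩ := others_spec (hR.valid t ht) hvt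
    set u := (others t v).1
    have hu : u ∈ tset t := by rw [hset]; simp
    have hu12 := lt_of_mem_tset (hR.valid t ht) hu
    have hpos : 0 < s.gsc v u := by
      rw [gsc_eq_length hR hv hu12 n1]
      apply List.length_pos_of_mem (a := t)
      unfold St.onSideL; rw [List.mem_filter]; simp only [Bool.and_eq_true]
      exact ⟨ht, tmem_iff.2 hvt, tmem_iff.2 hu⟩
    intro h0
    have hmem : s.gsc v u ∈ ((List.range' 0 12).filter fun u => u ≠ v).map fun u => s.gsc v u := by
      rw [List.mem_map]
      refine ⟨u, ?_, rfl⟩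
      rw [List.mem_filter, List.mem_range'_1]; simp only [decide_eq_true_eq]; exact ⟨by omega, n1.symm⟩
    have := List.single_le_sum (fun _ _ => Nat.zero_le _) _ hmem
    omega
  · intro h
    obtain ⟨x, hx, hx0⟩ : ∃ x ∈ ((List.range' 0 12).filter fun u => u ≠ v).map (fun u => s.gsc v u), x ≠ 0 := by
      by_contra hall
      push Not at hall
      exact h (List.sum_eq_zero hall)
    rw [List.mem_map] at hx
    obtain ⟨u, hu, rfl⟩ := hx
    rw [List.mem_filter, List.mem_range'_1] at hu
    simp only [decide_eq_true_eq] at hu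
    rw [gsc_eq_length hR hv (by omega) (Ne.symm hu.2)] at hx0
    obtain ⟨t, ht⟩ := List.exists_mem_of_ne_nil (s.onSideL v u) (fun e => hx0 (by rw [e]; rfl))
    unfold St.onSideL at ht; rw [List.mem_filter] at ht; simp only [Bool.and_eq_true] at ht
    exact ⟨t, ht.1, tmem_iff.1 ht.2.1⟩


/-- The true code of a side of a triangle of `M` means the truth. [folklore] -/
theorem domSem_trueCode (hR : Realizes M s) {p q : ℕ} (hp : p < 12) (hq : q < 12) (hpq : p ≠ q)
    {t : Finset ℕ} (hT : t ∈ M.T) (hpt : p ∈ t) (hqt : q ∈ t) :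
    DomSem (trueCode M s p q) (M.g p q) ∧ trueCode M s p q ≠ UNL := by
  unfold trueCode
  by_cases hl : s.gdom p q ≠ UNL
  · rw [if_pos hl]; exact ⟨hR.dom p q hp hq hpq, hl⟩
  · rw [if_neg hl]
    by_cases hg : M.g p q = 1 / 2
    · rw [if_pos hg]; exact ⟨Or.inr (Or.inl ⟨rfl, hg⟩), by unfold UNL; norm_num⟩
    · rw [if_neg hg]
      refine ⟨Or.inr (Or.inr ⟨validDom_mkR le_rfl (by unfold K; norm_num) le_rfl, by unfold FULLR mkR; norm_num, hg, ?_, ?_⟩),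
        by unfold FULLR mkR UNL K; norm_num⟩
      · have elo : rLo FULLR = 1 := by unfold rLo FULLR mkR K; norm_num
        rw [elo]
        have : gridPt (1 - 1) = -1 / 2 := by unfold gridPt; simp
        rw [this]
        have := M.side_bound t hT p hpt q hqt hpq
        push_cast; linarith
      · have ehi : rHi FULLR = K := by unfold rHi FULLR mkR K; norm_num
        rw [ehi]
        have : gridPt K = κ0 := by unfold gridPt K; ring
        rw [this]
        rcases M.dichot p q hp hq hpq with h | ⟨-, h⟩
        · exact absurd h hg
        · exact h

/-- **The true codes are among the label options** (in a realized state, for the two new sides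
of the missing triangle). [cite: Hales2012, Lemma 7] -/
theorem trueCode_mem_labelOpts (hR : Realizes M s) {p q : ℕ} (hp : p < 12) (hq : q < 12) (hpq : p ≠ q)
    {t : Finset ℕ} (hT : t ∈ M.T) (hpt : p ∈ t) (hqt : q ∈ t) :
    trueCode M s p q ∈ s.labelOpts p q := by
  classical
  unfold trueCode St.labelOpts
  by_cases hl : s.gdom p q ≠ UNL
  · rw [if_pos hl, if_pos hl]; simp
  · rw [if_neg hl, if_neg hl]
    push Not at hl
    by_cases hg : M.g p q = 1 / 2
    · rw [if_pos hg]
      -- a fifth contact is impossible at `p` and at `q`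
      have key : ∀ {x y : ℕ}, x < 12 → y < 12 → x ≠ y → s.gdom x y = UNL → M.g x y = 1 / 2 → s.cdeg x < 4 := by
        intro x y hx hy hxy hU hgxy
        rw [cdeg_eq]
        by_contra hge
        push Not at hge
        -- the contacts counted, plus `y`, are five distinct contacts of `x`
        have hle := M.cdeg_le x hx
        obtain ⟨Lc, hLc⟩ : ∃ Lc, Lc = (List.range' 0 12).filter fun u => u ≠ x ∧ s.gdom u x = 0 := ⟨_, rfl⟩
        rw [← hLc] at hge
        have hsub : insert y Lc.toFinset ⊆ (Finset.range 12).filter fun b => b ≠ x ∧ M.g x b = 1 / 2 := by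
          intro u hu
          rw [Finset.mem_insert] at hu
          rw [Finset.mem_filter, Finset.mem_range]
          rcases hu with rfl | hu
          · exact ⟨hy, hxy.symm, hgxy⟩
          · rw [List.mem_toFinset, hLc, List.mem_filter, List.mem_range'_1] at hu
            simp only [decide_eq_true_eq] at hu
            obtain ⟨hu12, hux, h0⟩ := hu
            refine ⟨by omega, hux, ?_⟩
            rcases hR.dom u x (by omega) hx hux with h | ⟨-, h⟩ | ⟨-, h, -⟩
            · rw [h0] at h; exact absurd h (by unfold UNL; norm_num)
            · rw [M.g_symm]; exact h
            · exact absurd h0 h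
        have hyL : y ∉ Lc.toFinset := by
          rw [List.mem_toFinset, hLc, List.mem_filter]
          simp only [decide_eq_true_eq, not_and]
          intro _ _
          rw [gdom_comm] at hU; rw [hU]; unfold UNL; norm_num
        have hcard := Finset.card_le_card hsub
        have hnd : Lc.Nodup := by rw [hLc]; exact List.Nodup.filter _ List.nodup_range'
        rw [Finset.card_insert_of_notMem hyL, List.toFinset_card_of_nodup hnd] at hcard
        omega
      have h1 := key hp hq hpq hl hg
      have h2 := key hq hp hpq.symm (by rw [gdom_comm]; exact hl) (by rw [M.g_symm]; exact hg)
      rw [if_pos ⟨h1, h2⟩]; simp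
    · rw [if_neg hg]
      -- an eighth long side is impossible
      have hlt : s.nlong < 7 := by
        rw [nlong_eq]
        by_contra hge
        push Not at hge
        have hle := M.card_longSides_le
        obtain ⟨Ll, hLl⟩ : ∃ Ll, Ll = (List.range' 0 144).filter fun i =>
            i / 12 < i % 12 ∧ s.dom.getD i UNL ≠ 0 ∧ s.dom.getD i UNL ≠ UNL := ⟨_, rfl⟩
        rw [← hLl] at hge
        -- inject `insert (sIdx p q) Ll` into the long sides
        have hsub : ∀ i ∈ insert (sIdx p q) Ll.toFinset, ({i / 12, i % 12} : Finset ℕ) ∈ M.longSides := by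
          intro i hi
          rw [Finset.mem_insert] at hi
          unfold KConf.longSides
          rw [Finset.mem_filter, M.mem_sides]
          rcases hi with rfl | hi
          · obtain ⟨e1, e2⟩ := sIdx_div_mod hp hq
            have hmin : min p q ≠ max p q := by omega
            refine ⟨⟨by rw [e1, e2, Finset.card_pair hmin], t, hT, ?_⟩, min p q, by rw [e1]; simp, max p q,
              by rw [e2]; simp, hmin, ?_⟩
            · rw [e1, e2]; intro x hx; simp only [Finset.mem_insert, Finset.mem_singleton] at hx
              rcases hx with rfl | rfl
              · rcases le_total p q with h | h
                · rw [min_eq_left h]; exact hpt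
                · rw [min_eq_right h]; exact hqt
              · rcases le_total p q with h | h
                · rw [max_eq_right h]; exact hqt
                · rw [max_eq_left h]; exact hpt
            · rcases le_total p q with h | h
              · rw [min_eq_left h, max_eq_right h]; exact hg
              · rw [min_eq_right h, max_eq_left h, M.g_symm]; exact hg
          · rw [List.mem_toFinset, hLl, List.mem_filter, List.mem_range'_1] at hi
            simp only [decide_eq_true_eq] at hi
            obtain ⟨hi144, hlt', h0, hU⟩ := hi
            have ha12 : i / 12 < 12 := by omega
            have hb12 : i % 12 < 12 := by omega
            have hab : i / 12 ≠ i % 12 := by omega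
            have hidx : sIdx (i / 12) (i % 12) = i := by unfold sIdx; rw [if_pos hlt']; omega
            have hgd : s.gdom (i / 12) (i % 12) = s.dom.getD i UNL := by unfold St.gdom; rw [hidx]
            obtain ⟨t', ht', hat, hbt⟩ := hR.lab_side _ _ ha12 hb12 hab (by rw [hgd]; exact hU)
            refine ⟨⟨by rw [Finset.card_pair hab], tset t', hR.mem t' ht', ?_⟩, i / 12, by simp, i % 12, by simp, hab, ?_⟩
            · intro x hx; simp only [Finset.mem_insert, Finset.mem_singleton] at hx
              rcases hx with rfl | rfl
              · exact hat
              · exact hbt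
            · rcases hR.dom _ _ ha12 hb12 hab with h | ⟨h, -⟩ | ⟨-, -, h, -⟩
              · rw [hgd] at h; exact absurd h hU
              · rw [hgd] at h; exact absurd h h0
              · exact h
        have hinj : Set.InjOn (fun i => ({i / 12, i % 12} : Finset ℕ)) (insert (sIdx p q) Ll.toFinset : Finset ℕ) := by
          intro i hi j hj e
          simp only at e
          have h1 : i / 12 ∈ ({j / 12, j % 12} : Finset ℕ) := by rw [← e]; simp
          have h2 : i % 12 ∈ ({j / 12, j % 12} : Finset ℕ) := by rw [← e]; simp
          simp only [Finset.mem_insert, Finset.mem_singleton] at h1 h2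
          -- both have `i/12 < i%12` and `j/12 < j%12`
          have li : i / 12 < i % 12 := by
            rw [Finset.mem_coe, Finset.mem_insert] at hi
            rcases hi with rfl | hi
            · have := sIdx_div_mod hp hq; omega
            · rw [List.mem_toFinset, hLl, List.mem_filter] at hi; simp only [decide_eq_true_eq] at hi; exact hi.2.1
          have lj : j / 12 < j % 12 := by
            rw [Finset.mem_coe, Finset.mem_insert] at hj
            rcases hj with rfl | hj
            · have := sIdx_div_mod hp hq; omega
            · rw [List.mem_toFinset, hLl, List.mem_filter] at hj; simp only [decide_eq_true_eq] at hj; exact hj.2.1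
          omega
        have hnot : sIdx p q ∉ Ll.toFinset := by
          rw [List.mem_toFinset, hLl, List.mem_filter]
          simp only [decide_eq_true_eq, not_and]
          intro _ _ _
          exact fun h => h hl
        have hcard := Finset.card_le_card_of_injOn _ hsub hinj
        have hnd : Ll.Nodup := by rw [hLl]; exact List.Nodup.filter _ List.nodup_range'
        rw [Finset.card_insert_of_notMem hnot, List.toFinset_card_of_nodup hnd] at hcard
        omega
      rw [if_pos hlt]; simp

/-- Filter-length bookkeeping for the new triangle. [folklore] -/
theorem length_filter_append_single {L : List ℕ} {p : ℕ → Bool} {t : ℕ} :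
    ((L ++ [t]).filter p).length = (L.filter p).length + (if p t then 1 else 0) := by
  rw [List.filter_append, List.length_append]
  by_cases h : p t = true
  · simp [h]
  · simp [h]

/-- Reading the side counts after `addTri`. [folklore] -/
theorem gsc_addTri_aux {sc : Array ℕ} (hsz : sc.size = 144) (a b c : ℕ) {p q : ℕ} (hp : p < 12) (hq : q < 12) :
    (((sc.modify (sIdx a b) (· + 1)).modify (sIdx a c) (· + 1)).modify (sIdx b c) (· + 1)).getD (sIdx p q) 0 =
      sc.getD (sIdx p q) 0 + (if sIdx p q = sIdx a b then 1 else 0) + (if sIdx p q = sIdx a c then 1 else 0) +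
        (if sIdx p q = sIdx b c then 1 else 0) := by
  have hidx := sIdx_lt hp hq
  rw [Array.getD_eq_getD_getElem?, Array.getD_eq_getD_getElem?]
  rw [Array.getElem?_modify, Array.getElem?_modify, Array.getElem?_modify]
  have hin : sIdx p q < sc.size := by rw [hsz]; exact hidx
  rw [Array.getElem?_eq_getElem hin]
  by_cases h1 : sIdx b c = sIdx p q <;> by_cases h2 : sIdx a c = sIdx p q <;> by_cases h3 : sIdx a b = sIdx p q <;>
    simp [h1, h2, h3, Ne.symm]

/-- **The growth step keeps the state realized.**  In a realized state, let `{v, a, c}` be a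
triangle of `M` that is not placed, with `v, a, c` distinct labels `< 12`; then `addTri v a c`
succeeds and, after writing the true codes on `{v, c}` and `{a, c}`, the state is realized —
provided the side `{v, a}` is already labelled. [folklore] -/
theorem realizes_grow (hR : Realizes M s) {v a c : ℕ} (hv : v < 12) (ha : a < 12) (hc : c < 12)
    (hva : v ≠ a) (hvc : v ≠ c) (hac : a ≠ c) (hT : ({v, a, c} : Finset ℕ) ∈ M.T)
    (hun : ∀ t ∈ s.tris.toList, tset t ≠ {v, a, c}) (hlab : s.gdom v a ≠ UNL) :
    ∃ s', s.addTri v a c = some s' ∧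
      Realizes M ((s'.sdom v c (trueCode M s v c)).sdom a c (trueCode M s a c)) ∧
      s'.tris.toList = s.tris.toList ++ [sortTri v a c] ∧ s'.dom = s.dom ∧
      (∀ p q, p < 12 → q < 12 → s'.gsc p q = s.gsc p q +
        (if sIdx p q = sIdx v a then 1 else 0) + (if sIdx p q = sIdx v c then 1 else 0) + (if sIdx p q = sIdx a c then 1 else 0)) := by
  classical
  obtain ⟨hval, hset⟩ := sortTri_valid hv ha hc hva hvc hac
  set t₁ := sortTri v a c with ht₁
  have hnot : t₁ ∉ s.tris.toList := fun h => hun t₁ h hset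
  -- the new side-count array and its reading
  have hgsc : ∀ p q, p < 12 → q < 12 →
      (⟨s.tris.push t₁, s.dom, ((s.sc.modify (sIdx v a) (· + 1)).modify (sIdx v c) (· + 1)).modify (sIdx a c) (· + 1)⟩ : St).gsc p q =
        s.gsc p q + (if sIdx p q = sIdx v a then 1 else 0) + (if sIdx p q = sIdx v c then 1 else 0) +
          (if sIdx p q = sIdx a c then 1 else 0) := by
    intro p q hp hq
    unfold St.gsc
    exact gsc_addTri_aux hR.size_sc v a c hp hq
  -- counts stay `≤ 2` on the three sides
  have hT2 : ∀ {p q : ℕ}, p < 12 → q < 12 → p ≠ q → p ∈ ({v, a, c} : Finset ℕ) → q ∈ ({v, a, c} : Finset ℕ) →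
      s.gsc p q ≤ 1 := by
    intro p q hp hq hpq hpm hqm
    -- the placed triangles on `{p, q}` inject into `M.onSide p q \\ {{v,a,c}}`
    rw [gsc_eq_length hR hp hq hpq]
    obtain ⟨hsub, hcard⟩ := card_image_onSideL hR p q
    have h2 : (M.onSide p q).card = 2 := M.two _ hT p hpm q hqm hpq
    have hnotin : ({v, a, c} : Finset ℕ) ∉ ((s.onSideL p q).map tset).toFinset := by
      rw [List.mem_toFinset, List.mem_map]
      rintro ⟨t, ht, e⟩
      unfold St.onSideL at ht
      exact hun t (List.mem_filter.1 ht).1 e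
    have hmem : ({v, a, c} : Finset ℕ) ∈ M.onSide p q := by
      unfold KConf.onSide; rw [Finset.mem_filter]; exact ⟨hT, hpm, hqm⟩
    have hss : ((s.onSideL p q).map tset).toFinset ⊂ M.onSide p q :=
      Finset.ssubset_iff_subset_ne.2 ⟨hsub, fun e => hnotin (e ▸ hmem)⟩
    have := Finset.card_lt_card hss
    rw [hcard, h2] at this
    omega
  have hmemv : v ∈ ({v, a, c} : Finset ℕ) := by simp
  have hmema : a ∈ ({v, a, c} : Finset ℕ) := by simp
  have hmemc : c ∈ ({v, a, c} : Finset ℕ) := by simp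
  have cva := hT2 hv ha hva hmemv hmema
  have cvc := hT2 hv hc hvc hmemv hmemc
  have cac := hT2 ha hc hac hmema hmemc
  -- `addTri` succeeds
  have hadd : s.addTri v a c =
      some ⟨s.tris.push t₁, s.dom, ((s.sc.modify (sIdx v a) (· + 1)).modify (sIdx v c) (· + 1)).modify (sIdx a c) (· + 1)⟩ := by
    unfold St.addTri
    rw [← ht₁]
    have hc1 : ¬ s.tris.contains t₁ = true := by
      rw [Array.contains_iff_mem, Array.mem_def]; exact hnot
    simp only [hc1, Bool.false_eq_true, ↓reduceIte]
    have e1 := hgsc v a hv ha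
    have e2 := hgsc v c hv hc
    have e3 := hgsc a c ha hc
    have n1 : sIdx v a ≠ sIdx v c := by rw [Ne, sIdx_eq_iff hv ha hv hc]; omega
    have n2 : sIdx v a ≠ sIdx a c := by rw [Ne, sIdx_eq_iff hv ha ha hc]; omega
    have n3 : sIdx v c ≠ sIdx a c := by rw [Ne, sIdx_eq_iff hv hc ha hc]; omega
    rw [if_neg]
    rw [e1, e2, e3]
    simp only [n1, n2, n3, Ne.symm n1, Ne.symm n2, Ne.symm n3, ↓reduceIte]
    omega
  refine ⟨_, hadd, ?_, by simp, rfl, hgsc⟩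
  -- the realized state after the two writes
  set s' : St := ⟨s.tris.push t₁, s.dom, ((s.sc.modify (sIdx v a) (· + 1)).modify (sIdx v c) (· + 1)).modify (sIdx a c) (· + 1)⟩
    with hs'
  have htris' : s'.tris.toList = s.tris.toList ++ [t₁] := by simp [hs']
  obtain ⟨semvc, nUvc⟩ := domSem_trueCode hR hv hc hvc hT hmemv hmemc
  obtain ⟨semac, nUac⟩ := domSem_trueCode hR ha hc hac hT hmema hmemc
  set r1 := trueCode M s v c
  set r2 := trueCode M s a c
  have n3 : sIdx v c ≠ sIdx a c := by rw [Ne, sIdx_eq_iff hv hc ha hc]; omega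
  -- reading the final domains
  have gd : ∀ p q, ((s'.sdom v c r1).sdom a c r2).gdom p q =
      if sIdx p q = sIdx a c then r2 else if sIdx p q = sIdx v c then r1 else s.gdom p q := by
    intro p q
    by_cases h1 : sIdx p q = sIdx a c
    · rw [if_pos h1]; unfold St.gdom; rw [h1]
      exact gdom_sdom_self (by rw [size_dom_sdom]; show sIdx a c < s.dom.size; rw [hR.size_dom]; exact sIdx_lt ha hc)
    · rw [if_neg h1, gdom_sdom_of_ne h1]
      by_cases h2 : sIdx p q = sIdx v c
      · rw [if_pos h2]; unfold St.gdom; rw [h2]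
        exact gdom_sdom_self (by show sIdx v c < s.dom.size; rw [hR.size_dom]; exact sIdx_lt hv hc)
      · rw [if_neg h2, gdom_sdom_of_ne h2]; rfl
  exact {
    size_dom := by rw [size_dom_sdom, size_dom_sdom]; exact hR.size_dom
    size_sc := by simp [hs', hR.size_sc]
    valid := by
      intro t ht
      simp only [tris_sdom, htris', List.mem_append, List.mem_singleton] at ht
      rcases ht with ht | rfl
      · exact hR.valid t ht
      · exact hval
    mem := by
      intro t ht
      simp only [tris_sdom, htris', List.mem_append, List.mem_singleton] at ht
      rcases ht with ht | rfl
      · exact hR.mem t ht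
      · rw [hset]; exact hT
    nodup := by
      simp only [tris_sdom, htris']
      exact List.nodup_append.2 ⟨hR.nodup, List.nodup_singleton _, fun t ht t' ht' => by
        rw [List.mem_singleton] at ht'; rw [ht']; exact fun e => hnot (e ▸ ht)⟩
    sc_eq := by
      intro p q hp hq hpq
      rw [gsc_sdom, gsc_sdom, hgsc p q hp hq, hR.sc_eq p q hp hq hpq]
      simp only [tris_sdom, htris']
      rw [length_filter_append_single]
      -- `p, q ∈ t₁` iff `{p, q}` is one of the three sides
      have hm : ((tmem t₁ p && tmem t₁ q) = true) = (p ∈ ({v, a, c} : Finset ℕ) ∧ q ∈ ({v, a, c} : Finset ℕ)) := by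
        rw [Bool.and_eq_true, tmem_iff, tmem_iff, hset]
      simp only [hm, Finset.mem_insert, Finset.mem_singleton, sIdx_eq_iff hp hq hv ha, sIdx_eq_iff hp hq hv hc,
        sIdx_eq_iff hp hq ha hc]
      split_ifs <;> omega
    dom := by
      intro p q hp hq hpq
      rw [gd]
      split_ifs with h1 h2
      · rcases (sIdx_eq_iff hp hq ha hc).1 h1 with ⟨rfl, rfl⟩ | ⟨rfl, rfl⟩
        · exact semac
        · rw [M.g_symm]; exact semac
      · rcases (sIdx_eq_iff hp hq hv hc).1 h2 with ⟨rfl, rfl⟩ | ⟨rfl, rfl⟩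
        · exact semvc
        · rw [M.g_symm]; exact semvc
      · exact hR.dom p q hp hq hpq
    lab_side := by
      intro p q hp hq hpq hl
      simp only [tris_sdom, htris']
      rw [gd] at hl
      have ht₁m : t₁ ∈ s.tris.toList ++ [t₁] := by simp
      split_ifs at hl with h1 h2
      · rcases (sIdx_eq_iff hp hq ha hc).1 h1 with ⟨rfl, rfl⟩ | ⟨rfl, rfl⟩
        · exact ⟨t₁, ht₁m, by rw [hset]; simp, by rw [hset]; simp⟩
        · exact ⟨t₁, ht₁m, by rw [hset]; simp, by rw [hset]; simp⟩
      · rcases (sIdx_eq_iff hp hq hv hc).1 h2 with ⟨rfl, rfl⟩ | ⟨rfl, rfl⟩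
        · exact ⟨t₁, ht₁m, by rw [hset]; simp, by rw [hset]; simp⟩
        · exact ⟨t₁, ht₁m, by rw [hset]; simp, by rw [hset]; simp⟩
      · obtain ⟨t, ht, h1', h2'⟩ := hR.lab_side p q hp hq hpq hl
        exact ⟨t, List.mem_append_left _ ht, h1', h2'⟩
    side_lab := by
      intro t ht p hp q hq hpq
      rw [gd]
      split_ifs with h1 h2
      · exact nUac
      · exact nUvc
      · simp only [tris_sdom, htris', List.mem_append, List.mem_singleton] at ht
        rcases ht with ht | rfl
        · exact hR.side_lab t ht p hp q hq hpq
        · -- a side of the new triangle other than `{v,c}`, `{a,c}`: it is `{v, a}`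
          rw [hset] at hp hq
          simp only [Finset.mem_insert, Finset.mem_singleton] at hp hq
          have hp12 : p < 12 := by rcases hp with rfl | rfl | rfl <;> assumption
          have hq12 : q < 12 := by rcases hq with rfl | rfl | rfl <;> assumption
          have hva' : sIdx p q = sIdx v a := by
            rw [sIdx_eq_iff hp12 hq12 hv ha]
            rw [sIdx_eq_iff hp12 hq12 hv hc] at h2
            rw [sIdx_eq_iff hp12 hq12 ha hc] at h1
            omega
          rw [show s.gdom p q = s.gdom v a by unfold St.gdom; rw [hva']]
          exact hlab }

end Grow

end KissingSearch

end Literature.Geometry.DiscreteGeometry
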